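import Mathlib
import Summits.Ventures.PercRepro.PuncturedLYMFibrationNodeFirst

/-!
# PercRepro — THE FIRST FAMILY FROM THE LOG-CONCAVITY OF THE SURVIVAL FRACTION AND AN EXPLICIT SLOPE INEQUALITY
(p10, gen 38)

At a node fibrated over a member of size `m` (PuncturedLYMFibrationNode / PuncturedLYMFibrationNodeFirst), the excess
of layer `b` is nonnegative iff `ψ b = (ρ·r (ℓ−b) − q (ℓ−b)) / r (ℓ−b+1) ≥ θ`.  Along the fibration recursion the
node's density `ρ` is large, and `ψ` is simply MONOTONE along the layers; then the first family needs neither the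
adjacent-row conditions nor the convexity of the chain, only: (a) the SURVIVAL FRACTION `r t / C(n', t)` of the other
members is LOG-CONCAVE in the level (`hIFR`, in the binomial-free form `r s · r (s+2) · (s+2)(n'−s) ≤ r (s+1)² ·
(s+1)(n'−s−1)`; the survival fraction is log-concave iff the hazard of the random chain is increasing), (b) the
ratio lemma `q s · r (s+1) ≤ q (s+1) · r s` (PuncturedLYMRatio), and (c) the EXPLICIT SLOPE INEQUALITY
`ρ·(n'+1) ≥ α_{s+1}·(s+2)(n'−s) − α_s·(s+1)(n'−s−1)` with `α_s = q s / r s` (cleared of denominators).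
`psi_step_of_ifr` is one layer step; `first_family_of_ifr` assembles the first family from (ii), the totals and these
three hypotheses at every layer step.  `r`, `q` are arbitrary sequences here; nothing asserts (a) or (c) for the
counts of a family.
-/

namespace PercRepro.PuncturedLYM.Split.NodeArith

open Finset OneArith

section

variable {m ℓ np : ℕ} {ρ θ : ℚ} {r q : ℕ → ℚ} {NC : ℚ}

/-- **One layer step.** If the survival fraction is log-concave at `s`, the ratio `q/r` increases from `s` to `s+1`
and the explicit slope inequality holds, then `ψ` does not decrease from level `s` to level `s + 1`. -/
theorem psi_step_of_ifr (s : ℕ) (hs : s + 2 ≤ np) (hr0 : 0 < r s) (hr1 : 0 < r (s + 1)) (hr2 : 0 < r (s + 2))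
    (hIFR : r s * r (s + 2) * (((s : ℚ) + 2) * ((np : ℚ) - s))
      ≤ r (s + 1) * r (s + 1) * (((s : ℚ) + 1) * ((np : ℚ) - s - 1)))
    (hratio : q s * r (s + 1) ≤ q (s + 1) * r s)
    (hslope : q (s + 1) * r s * (((s : ℚ) + 2) * ((np : ℚ) - s))
        - q s * r (s + 1) * (((s : ℚ) + 1) * ((np : ℚ) - s - 1))
      ≤ ρ * ((np : ℚ) + 1) * (r s * r (s + 1))) :
    (ρ * r s - q s) / r (s + 1) ≤ (ρ * r (s + 1) - q (s + 1)) / r (s + 2) := by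
  have hnp : (s : ℚ) + 2 ≤ np := by exact_mod_cast hs
  set A : ℚ := ((s : ℚ) + 1) * ((np : ℚ) - s - 1) with hA
  set B : ℚ := ((s : ℚ) + 2) * ((np : ℚ) - s) with hB
  have hApos : 0 < A := by rw [hA]; nlinarith
  have hBpos : 0 < B := by rw [hB]; nlinarith
  have hBA : B - A = (np : ℚ) + 1 := by rw [hA, hB]; ring
  -- `ρ ≥ α_{s+1} ≥ α_s` in cleared form: `ρ r s ≥ q s` and `ρ r (s+1) ≥ q (s+1)`
  have hρs1 : q (s + 1) * r s ≤ ρ * (r s * r (s + 1)) := by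
    -- `q (s+1) r s · (B − A) = q (s+1) r s · B − q (s+1) r s · A ≤ q (s+1) r s · B − q s r (s+1) · A ≤ ρ (np+1) r s r (s+1)`
    have h1 : q (s + 1) * r s * A ≥ q s * r (s + 1) * A := mul_le_mul_of_nonneg_right hratio hApos.le
    have h2 : q (s + 1) * r s * ((np : ℚ) + 1) ≤ ρ * ((np : ℚ) + 1) * (r s * r (s + 1)) := by
      rw [← hBA]; linarith
    have hnp1 : (0 : ℚ) < (np : ℚ) + 1 := by positivity
    have h3 : q (s + 1) * r s ≤ ρ * (r s * r (s + 1)) := by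
      have := h2
      rw [show q (s + 1) * r s * ((np : ℚ) + 1) = ((np : ℚ) + 1) * (q (s + 1) * r s) by ring,
        show ρ * ((np : ℚ) + 1) * (r s * r (s + 1)) = ((np : ℚ) + 1) * (ρ * (r s * r (s + 1))) by ring] at this
      exact le_of_mul_le_mul_left this hnp1
    exact h3
  have hρs : q s ≤ ρ * r s := by
    have h1 : q s * r (s + 1) ≤ ρ * r s * r (s + 1) := by linarith [hratio, hρs1]
    exact le_of_mul_le_mul_right h1 hr1
  -- the goal in cleared form: `(ρ r s − q s) r (s+2) ≤ (ρ r (s+1) − q (s+1)) r (s+1)`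
  rw [div_le_div_iff₀ hr1 hr2]
  -- IFR: `r s r (s+2) ≤ r (s+1)² A / B`, and `(ρ r s − q s) ≥ 0`
  have hfac : 0 ≤ ρ * r s - q s := by linarith
  -- `(ρ r s − q s) · r s r (s+2) · B ≤ (ρ r s − q s) · r (s+1)² · A`
  have h4 : (ρ * r s - q s) * (r s * r (s + 2) * B) ≤ (ρ * r s - q s) * (r (s + 1) * r (s + 1) * A) :=
    mul_le_mul_of_nonneg_left hIFR hfac
  -- the slope inequality times `r (s+1)`: `B (ρ r (s+1) − q (s+1)) r s ≥ A (ρ r s − q s) r (s+1)`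
  have h5 : A * ((ρ * r s - q s) * r (s + 1)) ≤ B * ((ρ * r (s + 1) - q (s + 1)) * r s) := by
    have hsl : q (s + 1) * r s * B - q s * r (s + 1) * A ≤ ρ * (B - A) * (r s * r (s + 1)) := by
      rw [hBA]; exact hslope
    have e : B * ((ρ * r (s + 1) - q (s + 1)) * r s) - A * ((ρ * r s - q s) * r (s + 1))
        = ρ * (B - A) * (r s * r (s + 1)) - (q (s + 1) * r s * B - q s * r (s + 1) * A) := by ring
    linarith [hsl, e]
  -- combine: `(ρ r s − q s) r (s+2) · (r s · B) ≤ (ρ r s − q s) r (s+1)² A ≤ ...`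
  have h6 : (ρ * r s - q s) * r (s + 2) * (r s * B) ≤ (ρ * r (s + 1) - q (s + 1)) * r (s + 1) * (r s * B) := by
    have e1 : (ρ * r s - q s) * r (s + 2) * (r s * B) = (ρ * r s - q s) * (r s * r (s + 2) * B) := by ring
    have e2 : (ρ * r s - q s) * (r (s + 1) * r (s + 1) * A) = r (s + 1) * (A * ((ρ * r s - q s) * r (s + 1))) := by ring
    have e3 : (ρ * r (s + 1) - q (s + 1)) * r (s + 1) * (r s * B) = r (s + 1) * (B * ((ρ * r (s + 1) - q (s + 1)) * r s)) := by ring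
    rw [e1, e3]
    calc (ρ * r s - q s) * (r s * r (s + 2) * B) ≤ (ρ * r s - q s) * (r (s + 1) * r (s + 1) * A) := h4
      _ = r (s + 1) * (A * ((ρ * r s - q s) * r (s + 1))) := e2
      _ ≤ r (s + 1) * (B * ((ρ * r (s + 1) - q (s + 1)) * r s)) := mul_le_mul_of_nonneg_left h5 hr1.le
  have hpos : 0 < r s * B := mul_pos hr0 hBpos
  exact le_of_mul_le_mul_right h6 hpos

/-- **THE FIRST FAMILY FROM IFR AND THE SLOPE INEQUALITY.** If every layer has rows and free columns, and at every
layer step `s = ℓ − c − 1` (`c + 1 < m`) the survival fraction is log-concave, the ratio `q/r` increases and the explicit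
slope inequality holds, then `ψ` is antitone along the layers, the nonnegative excesses form an initial segment, and
the first family follows from `0 ≤ en 0` and the totals. -/
theorem first_family_of_ifr (hmℓ : m ≤ ℓ) (hℓ : ℓ + 1 ≤ np)
    (hr : ∀ c, c < m → 0 < r (ℓ - c)) (hr' : ∀ c, c < m → 0 < r (ℓ - c + 1))
    (hIFR : ∀ s, ℓ - m + 1 ≤ s → s + 1 < ℓ + 1 → r s * r (s + 2) * (((s : ℚ) + 2) * ((np : ℚ) - s))
      ≤ r (s + 1) * r (s + 1) * (((s : ℚ) + 1) * ((np : ℚ) - s - 1)))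
    (hratio : ∀ s, ℓ - m + 1 ≤ s → s + 1 < ℓ + 1 → q s * r (s + 1) ≤ q (s + 1) * r s)
    (hslope : ∀ s, ℓ - m + 1 ≤ s → s + 1 < ℓ + 1 →
      q (s + 1) * r s * (((s : ℚ) + 2) * ((np : ℚ) - s))
        - q s * r (s + 1) * (((s : ℚ) + 1) * ((np : ℚ) - s - 1))
      ≤ ρ * ((np : ℚ) + 1) * (r s * r (s + 1)))
    (h0 : 0 ≤ en m ℓ ρ θ r q 0) (htot : Hn m ℓ ρ θ r q m = NC) (hNC : 0 ≤ NC) :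
    ∀ a, a ≤ m → 0 ≤ Hn m ℓ ρ θ r q a := by
  apply first_family_of_interval _ h0 htot hNC
  apply interval_of_quasiconcave hr'
  -- `ψ` is antitone along the layers
  have hstep : ∀ c, c + 1 < m → psi ℓ ρ r q (c + 1) ≤ psi ℓ ρ r q c := by
    intro c hc
    obtain ⟨s, hs⟩ : ∃ s, s = ℓ - (c + 1) := ⟨_, rfl⟩
    have e1 : ℓ - (c + 1) = s := hs.symm
    have e2 : ℓ - c = s + 1 := by omega
    have g1 : psi ℓ ρ r q (c + 1) = (ρ * r s - q s) / r (s + 1) := by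
      unfold psi; rw [e1]
    have g2 : psi ℓ ρ r q c = (ρ * r (s + 1) - q (s + 1)) / r (s + 2) := by
      unfold psi; rw [e2]
    rw [g1, g2]
    have hsrange1 : ℓ - m + 1 ≤ s := by omega
    have hsrange2 : s + 1 < ℓ + 1 := by omega
    have hsnp : s + 2 ≤ np := by omega
    have hr0 : 0 < r s := by have := hr (c + 1) hc; rwa [e1] at this
    have hr1 : 0 < r (s + 1) := by have := hr c (by omega); rwa [e2] at this
    have hr2 : 0 < r (s + 2) := by have := hr' c (by omega); rwa [e2] at this
    exact psi_step_of_ifr s hsnp hr0 hr1 hr2 (hIFR s hsrange1 hsrange2) (hratio s hsrange1 hsrange2)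
      (hslope s hsrange1 hsrange2)
  have hanti : ∀ b b', b ≤ b' → b' < m → psi ℓ ρ r q b' ≤ psi ℓ ρ r q b := by
    intro b b' hbb' hb'
    obtain ⟨d, hd⟩ : ∃ d, b' = b + d := ⟨b' - b, by omega⟩
    subst hd
    induction d with
    | zero => simp
    | succ d ih =>
      have h1 := hstep (b + d) (by omega)
      have h2 := ih (by omega) (by omega)
      rw [show b + (d + 1) = b + d + 1 by omega]
      exact h1.trans h2
  intro b b' b'' hbb' hb'b'' hb''
  exact (min_le_right _ _).trans (hanti b' b'' hb'b'' hb'')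

end

end PercRepro.PuncturedLYM.Split.NodeArith
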